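import Literature.AnabelianGeometry.AbsoluteAnabelian.AbsTopII.EllipticCuspidalizationTF
import Literature.AnabelianGeometry.AbsoluteAnabelian.AbsTopII.EllipticCuspidalizationComparisonTF
import HarnessLib

/-!
# [AbsTopII] Cor 3.3 (iii) over a class `𝒟`, concluding in the PRINT-FAITHFUL output structure
# `EllipticCuspidalizationTF` — successors of `EllipticModel.Cor_3_3_iii` (F-0291; `Matches` = F-0293) and of the datum
# retype `EllipticDatumModel.Cor_3_3_iii'`, with the one-way transfers from the predecessors

S. Mochizuki, *Topics in Absolute Anabelian Geometry II: Decomposition Groups and Endomorphisms*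
[AbsTopII] (bib `MochizukiAbsTopII2013`; kurims manuscript `paper:url-585b8d0ad0d9`, cell render
`HOME/lit/renders/AbsTopII-kurims-url-585b8d0ad0d9/p0068.txt`), §3, Corollary 3.3 (iii) pp. 68–69:
"for any `G' ⊆ G` that is sufficiently small, where 'sufficiently' depends only on `N`, the natural
surjection `Π_{U_X} ↠ Π` — i.e., 'cuspidalization' of `Π` — may be constructed via 'group-theoretic'
operations as follows: (a) [...] (b) [...] (c) [...]"; (ii) p. 68: "`J ∩ Δ_C` [...] is torsion-free
[i.e., the covering determined by `J` is a scheme — cf. [AbsTopI], Lemma 4.1, (iv)]".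

WHY THIS FILE (cell abc-iut, row «TORSIONFREE-SUCCESSOR» phase 2b, abc-iut-L4-lead m151 (6) /
m156 (2); seat abc-iut-L4-t4 gen 12; sequel of `EllipticCuspidalizationTF.lean`).  As typed, the
named facts `EllipticModel.Cor_3_3_iii` (abc-iut-L4-t6, FACT-LIST F-0291; its `Matches` clause is F-0293) and
`EllipticDatumModel.Cor_3_3_iii'` (abc-iut-L4-t4, row «COR33-RETYPE») conclude
"`∃ C : EllipticCuspidalization …`", whose field (ii) is Mathlib's unique-roots class — UNSATISFIABLE
at genuine data by finding T1g11-F1 (`Summit.ABC.IUTFork.ellipticCuspidalization_not_surjective_S3`),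
so those conclusions are FALSE at genuine shape, not merely unproved.  DEFS-freeze: nothing landed is
edited.  This file mints, in NEW declarations only, the successors concluding in the print-faithful
output `EllipticCuspidalizationTF` (field (ii) = «no nontrivial element of finite order»):
`EllipticModel.MatchesTF` / `Cor_3_3_iiiTF`, `EllipticDatumModel.MatchesTF` / `Cor_3_3_iiiTF'`; the
DEFINITIONAL identities `matches_toTF_iff` (a landed output matches a setting iff its print-faithful
image does); the ONE-WAY TRANSFERS `Cor_3_3_iii.toTF : Cor_3_3_iii → Cor_3_3_iiiTF`,
`Cor_3_3_iii'.toTF` (the successor is implied by the predecessor — every landed closer of (iii)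
carries over in one line, e.g. `cor_3_3_iiiTF_of_ex_4_8_i` from abc-iut-L4-t6's
`cor_3_3_iii_of_ex_4_8_i`).

HONEST FRAMING: statements about OUR typing; the successors are unproved named facts like their
predecessors (weaker conclusions); nothing here bears on [IUTchIII] Cor 3.12 or asserts that abc is
proved or refuted.  No instance, no notation; axioms standard.
-/

noncomputable section

open CategoryTheory Topology
open scoped Pointwise

universe u

namespace Literature.AnabelianGeometry.AbsoluteAnabelian.AbsTopII

open Literature.AlgebraicGeometry.Frobenioids (IsSlimGroup)
open FundamentalExtension
open AbsTopI (ConstructionDataClass)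
open AugmentedProfiniteGrp

/-! ### Printed generality `(𝒟, M)`: successors of F-0291 (`Cor_3_3_iii`) and F-0293 (`Matches`) -/

namespace EllipticModel

variable {𝒟 : ConstructionDataClass.{u}} (M : EllipticModel 𝒟)

/-- The PRINT-FAITHFUL output `C : EllipticCuspidalizationTF` *matches the setting* `s`: same `N`
and `Σ`, its core is the `k`-core (an isomorphism of extensions under `Π`, carrying `C.PiD` to `Π_D`),
its `Π_V` is the given one, its output `Π_{U_X} ↠ Π` is isomorphic over `Π` to the natural surjection,
and (c) the decomposition groups of the removed points agree — VERBATIM the landed `Matches` over the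
successor structure. [cite: MochizukiAbsTopII2013, Cor 3.3 (iii) p.68] -/
def MatchesTF {b : 𝒟.Base} {X : (𝒟.datum b).Obj} (s : M.Setting b X)
    (C : EllipticCuspidalizationTF ((𝒟.datum b).ext X)) : Prop :=
  C.N = M.level s ∧ C.Sigma = (𝒟.datum b).primes ∧
    (∃ e : C.core ≅ M.coreExt b X, C.toCore ≫ e.hom = M.toCore b X ∧
      C.PiD.map e.hom.arith.toMonoidHom = M.PiD s) ∧
    C.PiV = M.PiV s ∧ C.toCuspidalization.IsoOver (M.cuspUX s) ∧
    C.toCuspidalization.decompositionImages C.cusps =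
      (M.cuspUX s).decompositionImages (M.cuspsUX s)

/-- A landed output matches a setting iff its print-faithful image does (definitional).
[cite: MochizukiAbsTopII2013, Cor 3.3 (iii) p.68] -/
theorem matches_toTF_iff {b : 𝒟.Base} {X : (𝒟.datum b).Obj} (s : M.Setting b X)
    (C : EllipticCuspidalization ((𝒟.datum b).ext X)) : M.MatchesTF s C.toTF ↔ M.Matches s C :=
  Iff.rfl

/-- **Corollary 3.3 (iii)** pp. 68–69 relative to `(𝒟, M)`, PRINT-FAITHFUL successor of
`EllipticModel.Cor_3_3_iii` (FACT-LIST F-0291; `Matches` = F-0293; finding T1g11-F1): under the `𝒟`-hypotheses and the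
standing hypotheses, "for any `G' ⊆ G` that is sufficiently small, where 'sufficiently' depends only
on `N`, the natural surjection `Π_{U_X} ↠ Π` — i.e., 'cuspidalization' of `Π` — may be constructed
via 'group-theoretic' operations as follows: (a) There exists a [not necessarily unique] `Π`-chain
[...] with associated type-chain `⋏, ⋎, ⋏, •, …, •, ⋏, ⋎` [...] that admits a terminal isomorphism
with the trivial `Π`-chain [...]; (b) [...]; (c) [...]."  TYPED: as the predecessor, but the output
is a print-faithful `EllipticCuspidalizationTF` (field (ii): `Π_D ∩ Δ_C` has no nontrivial element of
finite order). [cite: MochizukiAbsTopII2013, Cor 3.3 (iii) pp.68-69] -/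
def Cor_3_3_iiiTF : Prop :=
  𝒟.IsChainFull → 𝒟.RelIsomDGC →
    ∀ (b : 𝒟.Base) (X : (𝒟.datum b).Obj) (h : M.IsCor33Member b X) (N : ℕ),
      ∃ G₀ : Subgroup ((𝒟.datum b).ext X).gal, IsOpen (G₀ : Set ((𝒟.datum b).ext X).gal) ∧
        ∀ s : M.Setting b X, M.level s = N → M.galOpen s ≤ G₀ →
          ∃ C : EllipticCuspidalizationTF ((𝒟.datum b).ext X), M.MatchesTF s C ∧
            HasProSigmaTerminalChainOfType (𝒟.datum b).primes (M.cusps b X) h.arith_slim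
              h.geom_slim h.geom_ne_bot C.typeChain C.PiV

/-- **One-way transfer**: the landed `Cor_3_3_iii` IMPLIES its print-faithful successor (push the
output through `EllipticCuspidalization.toTF`; all other clauses are untouched).
[cite: MochizukiAbsTopII2013, Cor 3.3 (iii) pp.68-69] -/
theorem Cor_3_3_iii.toTF {M : EllipticModel 𝒟} (h : M.Cor_3_3_iii) : M.Cor_3_3_iiiTF := by
  intro hfull hrel b X hX N
  obtain ⟨G₀, hG₀, hs⟩ := h hfull hrel b X hX N
  refine ⟨G₀, hG₀, fun s hN hle => ?_⟩
  obtain ⟨C, hC, hchain⟩ := hs s hN hle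
  exact ⟨C.toTF, (M.matches_toTF_iff s C).mpr hC, hchain⟩

/-- **Cor 3.3 (iii) with Rmk 3.3.1, print-faithful output** (one-line transfer of abc-iut-L4-t6's
`cor_3_3_iii_of_ex_4_8_i`): over the class of [AbsTopI] Ex 4.8 (i), given the named facts `Ex_4_8_i`
and `Cor_3_3_iii`, every `Π`-elliptically admissible member (slim nontrivial `Δ`) admits, for small
`G'`, a PRINT-FAITHFUL elliptic cuspidalization matching each setting.
[cite: MochizukiAbsTopII2013, Rmk 3.3.1 p.69] -/
theorem cor_3_3_iiiTF_of_ex_4_8_i {p : ℕ} [Fact p.Prime] (h𝒟 : 𝒟.IsEx48ClassGen p)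
    (hEx : 𝒟.Ex_4_8_i p) (h33 : M.Cor_3_3_iii) {b : 𝒟.Base} {X : (𝒟.datum b).Obj}
    (hmem : 𝒟.Mem b X) (hadm : M.IsEllipticallyAdmissible b X)
    (hΔ : IsSlimGroup ((𝒟.datum b).ext X).geom) (hne : ((𝒟.datum b).ext X).geom ≠ ⊥) (N : ℕ) :
    ∃ G₀ : Subgroup ((𝒟.datum b).ext X).gal, IsOpen (G₀ : Set ((𝒟.datum b).ext X).gal) ∧
      ∀ s : M.Setting b X, M.level s = N → M.galOpen s ≤ G₀ →
        ∃ C : EllipticCuspidalizationTF ((𝒟.datum b).ext X), M.MatchesTF s C ∧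
          HasProSigmaTerminalChainOfType (𝒟.datum b).primes (M.cusps b X)
            (M.isCor33Member_of_ex_4_8_i h𝒟 hEx hmem hadm hΔ hne).arith_slim hΔ hne
            C.typeChain C.PiV :=
  (Cor_3_3_iii.toTF h33) (hEx h𝒟).1 (hEx h𝒟).2.1 b X
    (M.isCor33Member_of_ex_4_8_i h𝒟 hEx hmem hadm hΔ hne) N

/-- The successor output of ANY print-faithful match has its `Π_D` in the print-faithful right-hand
side of Cor 3.3 (ii) for its core (clause (ii) of the output, read back).
[cite: MochizukiAbsTopII2013, Cor 3.3 (ii) p.68] -/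
theorem MatchesTF.PiD_mem {M : EllipticModel 𝒟} {b : 𝒟.Base} {X : (𝒟.datum b).Obj}
    {s : M.Setting b X} {C : EllipticCuspidalizationTF ((𝒟.datum b).ext X)} (_h : M.MatchesTF s C) :
    C.PiD ∈ semiEllipticDoubleCoverSubgroupsTF C.core :=
  C.PiD_mem_semiEllipticDoubleCoverSubgroupsTF

end EllipticModel

/-! ### Relative to the datum (abc-iut-L4-t4's COR33-RETYPE): successor of `Cor_3_3_iii'` -/

namespace EllipticDatumModel

variable {𝒟 : ConstructionDataClass.{u}} (M : EllipticDatumModel 𝒟)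

/-- The PRINT-FAITHFUL output `K : EllipticCuspidalizationTF` *matches the setting* `s = (φ, g,
Π_D, G', N, Π_V)` at the datum core `f : X → C`, THE SCHEME SIDE READ IN THE DATUM — VERBATIM the
landed `EllipticDatumModel.Matches` over the successor structure: same `N`, `Σ`; core = `Π_C` under
`Π` carrying `K.PiD` to `Π_D`; `Π_V`; output `Π_{U_X} ↠ Π` = `[π₁(ι)]` of a datum open immersion
`ι : U → X`; cusps clause (c). [cite: MochizukiAbsTopII2013, Cor 3.3 (iii) p.68] -/
def MatchesTF {b : 𝒟.Base} {X C : (𝒟.datum b).Obj} {f : (𝒟.datum b).Hom X C} (s : M.Setting b X C f)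
    (K : EllipticCuspidalizationTF ((𝒟.datum b).ext X)) : Prop :=
  K.N = s.level ∧ K.Sigma = (𝒟.datum b).primes ∧
    (∃ e : K.core ≅ (𝒟.datum b).ext C, K.toCore ≫ e.hom = s.toCore.toExtensionHom ∧
      K.PiD.map e.hom.arith.toMonoidHom = s.PiD) ∧
    K.PiV = s.PiV ∧
    ∃ (U : (𝒟.datum b).Obj) (ι : (𝒟.datum b).Hom U X)
      (ψ : HomOver ((𝒟.datum b).grp U) ((𝒟.datum b).grp X)),
      M.IsOpenImmersion ι ∧ OuterHom.mk ψ = (𝒟.datum b).outerHom ι ∧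
        (∃ β : K.cuspUX.arith ≃ₜ* ((𝒟.datum b).ext U).arith, ∀ x, ψ.toHom (β x) = K.proj.arith x) ∧
        K.toCuspidalization.decompositionImages K.cusps =
          {P | ∃ (x : (M.cusps b U).Cusp) (g : ((𝒟.datum b).ext U).arith),
            P = (MulAut.conj g • (M.cusps b U).Dcusp x).map ψ.toHom.toMonoidHom}

/-- A landed output matches a datum setting iff its print-faithful image does (definitional).
[cite: MochizukiAbsTopII2013, Cor 3.3 (iii) p.68] -/
theorem matches_toTF_iff {b : 𝒟.Base} {X C : (𝒟.datum b).Obj} {f : (𝒟.datum b).Hom X C}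
    (s : M.Setting b X C f) (K : EllipticCuspidalization ((𝒟.datum b).ext X)) :
    M.MatchesTF s K.toTF ↔ M.Matches s K :=
  Iff.rfl

/-- **Corollary 3.3 (iii′)** pp. 68–69 relative to the datum, PRINT-FAITHFUL successor of
`EllipticDatumModel.Cor_3_3_iii'` (finding T1g11-F1): for every datum core `f : X → C` and every `N`,
for `G' ⊆ G₀(N)`, every setting `s` is matched by some print-faithful `EllipticCuspidalizationTF` of
`Π ↠ G` (`MatchesTF`) whose type-chain / `Π_V` are those of a genuine pro-`Σ` `Π`-chain with a
terminal isomorphism to the trivial chain (`HasProSigmaTerminalChainOfType`).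
[cite: MochizukiAbsTopII2013, Cor 3.3 (iii) pp.68-69] -/
def Cor_3_3_iiiTF' : Prop :=
  𝒟.IsChainFull → 𝒟.RelIsomDGC →
    ∀ (b : 𝒟.Base) (X : (𝒟.datum b).Obj) (h : M.IsCor33Member b X) (C : (𝒟.datum b).Obj)
      (f : (𝒟.datum b).Hom X C), M.IsFinEt f → M.IsCoreOf b C X → ∀ N : ℕ,
      ∃ G₀ : Subgroup ((𝒟.datum b).ext X).gal, IsOpen (G₀ : Set ((𝒟.datum b).ext X).gal) ∧
        ∀ s : M.Setting b X C f, s.level = N → s.galOpen ≤ G₀ →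
          ∃ K : EllipticCuspidalizationTF ((𝒟.datum b).ext X), M.MatchesTF s K ∧
            HasProSigmaTerminalChainOfType (𝒟.datum b).primes (M.cusps b X)
              (((𝒟.datum b).ext X).arith_slim_of_geom_slim_of_gal_slim h.geom_slim h.slim)
              h.geom_slim h.geom_ne_bot K.typeChain K.PiV

/-- **One-way transfer**: the landed `Cor_3_3_iii'` IMPLIES its print-faithful successor.
[cite: MochizukiAbsTopII2013, Cor 3.3 (iii) pp.68-69] -/
theorem Cor_3_3_iii'.toTF {M : EllipticDatumModel 𝒟} (h : M.Cor_3_3_iii') : M.Cor_3_3_iiiTF' := by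
  intro hfull hrel b X hX C f hf hcore N
  obtain ⟨G₀, hG₀, hs⟩ := h hfull hrel b X hX C f hf hcore N
  refine ⟨G₀, hG₀, fun s hN hle => ?_⟩
  obtain ⟨K, hK, hchain⟩ := hs s hN hle
  exact ⟨K.toTF, (M.matches_toTF_iff s K).mpr hK, hchain⟩

end EllipticDatumModel

end Literature.AnabelianGeometry.AbsoluteAnabelian.AbsTopII

end
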